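import Summits.Ventures.GridStability.Models.DroopVoltageBox

/-!
# GridStability/Models/DroopVoltageAttract — the voltage box of the droop microgrid with Q–V dynamics is GLOBALLY ATTRACTING: exponential contraction of every larger box (certificate-free, every `n`)

Cell `gridfusion` (LADDER-GRIDFUSION, apex line G3.b; seat gridfusion-model-3 (g7)). Upgrade of
`Models/DroopVoltageBox.lean` (★ #87: the weighted box `Π_i [0, λ w_i]` is positively invariant for every
`λ w_i > b_i`) from INVARIANCE to ATTRACTION, for the droop microgrid with Q–V dynamics in bus-admittance form
[cite: ShinZavala2020, (1a)–(1b), (8a)–(8c)] = [cite: KunduEtAl2019, (4a)–(4c)] (typed `DroopMicrogrid.field`).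

IDEA (no Dini derivatives). Fold a SHRINKING level into the barriers of the tree's Nagumo lemma
`Literature.Analysis.ODE.forall_le_of_hasDerivWithinAt_of_eq_imp_deriv_neg`: with `λ_b` any level carrying
the set-point data (`b_i = v_i⁰ + λ^q_i Q_i^set ≤ λ_b w_i`), a start level `Λ₀ > λ_b` and a rate
`μ < 1/τ_Qi`, put `c(t) := λ_b + (Λ₀ − λ_b) e^{−μ t}`. On the moving face `V_i = c(t) w_i` (others below)
the weighted dominance gives `Q_i ≥ 0`, so `τ_Qi V̇_i ≤ b_i − c(t) w_i ≤ −(c(t) − λ_b) w_i`, while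
`d/dt (c(t) w_i) = −μ (c(t) − λ_b) w_i`; hence `d/dt (V_i − c(t) w_i) ≤ (c(t) − λ_b) w_i (μ − 1/τ_Qi) < 0`.

WHAT IS CERTIFIED (`voltage_attract`): under `τ_Qi > 0`, `λ^q_i ≥ 0`, `b_i > 0`, positive weights with
`Σ_{j≠i} (|G_ij| + |B_ij|) w_j ≤ −B_ii w_i`, `b_i ≤ λ_b w_i`, `λ_b < Λ₀`, `μ τ_Qi < 1`: along every
solution of the FULL model on `[0, T]` with `0 ≤ V_i(0) ≤ Λ₀ w_i`, for all `t ∈ [0, T]` and all `i`,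
`0 ≤ V_i(t) ≤ (λ_b + (Λ₀ − λ_b) e^{−μ t}) w_i` — ANGLES AND FREQUENCIES ARBITRARY. Since every nonnegative
initial voltage vector lies in SOME `Λ₀`-box, the box `Π_i [0, λ_b w_i]` attracts every motion with
nonnegative initial voltages, exponentially at any rate below `min_i 1/τ_Qi` (`voltage_attract_of_nonneg`).

THREE COLUMNS. CERTIFIED: the inequalities (std axioms). MODELLED: (4a)–(4c), bus-admittance form
(MV-6N/V0), TRUE reduced self-susceptances, no limiter. An ultimate bound on the voltage magnitudes of the
MODEL — not voltage-regulation quality, not synchronisation (angles free), nothing about a device.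
VALIDATED: nothing.
-/

noncomputable section

open Real Set Finset

namespace Summit.Ventures.GridStability.Models.DroopMicrogrid

variable {n : ℕ} (mg : DroopMicrogrid n)

/-- The shrinking level `c(t) = λ_b + (Λ₀ − λ_b) e^{−μ t}`. -/
def shrinkLevel (lamb Λ₀ μ t : ℝ) : ℝ := lamb + (Λ₀ - lamb) * exp (-(μ * t))

/-- `c′(t) = −μ (Λ₀ − λ_b) e^{−μ t} = −μ (c(t) − λ_b)`. -/
theorem hasDerivAt_shrinkLevel (lamb Λ₀ μ t : ℝ) :
    HasDerivAt (fun s => shrinkLevel lamb Λ₀ μ s) (-(μ * (shrinkLevel lamb Λ₀ μ t - lamb))) t := by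
  unfold shrinkLevel
  have h1 : HasDerivAt (fun s => -(μ * s)) (-(μ * 1)) t := ((hasDerivAt_id' t).const_mul μ).neg
  have h2 := (h1.exp.const_mul (Λ₀ - lamb)).const_add lamb
  refine h2.congr_deriv ?_
  ring

/-- `c(t) > λ_b` for all `t` when `Λ₀ > λ_b`. -/
theorem lamb_lt_shrinkLevel {lamb Λ₀ : ℝ} (h : lamb < Λ₀) (μ t : ℝ) : lamb < shrinkLevel lamb Λ₀ μ t := by
  unfold shrinkLevel
  have := exp_pos (-(μ * t))
  nlinarith

variable {mg}

/-- **The voltage box is globally attracting (every `n`).** Assume `τ_Qi > 0`, `λ^q_i ≥ 0`,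
`b_i = v_i⁰ + λ^q_i Q_i^set > 0`, positive weights `w` with `Σ_{j≠i} (|G_ij| + |B_ij|) w_j ≤ −B_ii w_i`,
a level `λ_b` with `b_i ≤ λ_b w_i`, a start level `Λ₀ > λ_b` and a rate `μ` with `μ τ_Qi < 1` for all `i` (`0 < μ < min_i 1/τ_Qi` is the
contracting case; `μ = 0` is box invariance at level `Λ₀`).
Then along every solution of (4a)–(4c) on `[0, T]` with `0 ≤ V_i(0) ≤ Λ₀ w_i`:
`0 ≤ V_i(t) ≤ (λ_b + (Λ₀ − λ_b) e^{−μ t}) w_i` for all `t ∈ [0, T]` and all `i` — the `Λ₀`-box contracts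
exponentially onto the `λ_b`-box, angles and frequencies arbitrary. MODELLED: bus-admittance droop
microgrid (MV-6N/V0); an ultimate bound, not a regulation statement. -/
theorem voltage_attract (hτ : ∀ i, 0 < mg.τQ i) (hkQ : ∀ i, 0 ≤ mg.kQ i)
    (hb : ∀ i, 0 < mg.Vset i + mg.kQ i * mg.Qset i)
    {w : Fin n → ℝ} (hw : ∀ i, 0 < w i)
    (hdom : ∀ i, ∑ j ∈ univ.erase i, (|mg.G i j| + |mg.B i j|) * w j ≤ -mg.B i i * w i)
    {lamb : ℝ} (hlamb : ∀ i, mg.Vset i + mg.kQ i * mg.Qset i ≤ lamb * w i)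
    {Λ₀ : ℝ} (hΛ : lamb < Λ₀) {μ : ℝ} (hμ : ∀ i, μ * mg.τQ i < 1)
    {T : ℝ} {γ : ℝ → State n} (h : mg.IsSolutionOn γ (Icc 0 T))
    (h0 : ∀ i, 0 ≤ (γ 0).2.2 i ∧ (γ 0).2.2 i ≤ Λ₀ * w i) :
    ∀ t ∈ Icc 0 T, ∀ i, 0 ≤ (γ t).2.2 i ∧ (γ t).2.2 i ≤ shrinkLevel lamb Λ₀ μ t * w i := by
  classical
  set c : ℝ → ℝ := fun t => shrinkLevel lamb Λ₀ μ t with hcdef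
  set hf : Fin n ⊕ Fin n → ℝ → ℝ :=
    Sum.elim (fun i t => -(γ t).2.2 i) (fun i t => (γ t).2.2 i - c t * w i) with hhf
  set hf' : Fin n ⊕ Fin n → ℝ → ℝ :=
    Sum.elim (fun i t => -mg.dV (γ t) i) (fun i t => mg.dV (γ t) i + μ * (c t - lamb) * w i) with hhf'
  set lev : Fin n ⊕ Fin n → ℝ := fun _ => 0 with hlev
  have hder : ∀ k, ∀ t ∈ Icc 0 T, HasDerivWithinAt (hf k) (hf' k t) (Icc 0 T) t := by
    rintro (i | i) t ht
    · show HasDerivWithinAt (fun τ => -(γ τ).2.2 i) (-mg.dV (γ t) i) (Icc 0 T) t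
      exact (mg.hasDerivWithinAt_voltage h ht i).neg
    · show HasDerivWithinAt (fun τ => (γ τ).2.2 i - c τ * w i)
        (mg.dV (γ t) i + μ * (c t - lamb) * w i) (Icc 0 T) t
      have h1 := mg.hasDerivWithinAt_voltage h ht i
      have h2 : HasDerivWithinAt (fun τ => c τ * w i) (-(μ * (c t - lamb)) * w i) (Icc 0 T) t :=
        ((hasDerivAt_shrinkLevel lamb Λ₀ μ t).hasDerivWithinAt).mul_const (w i)
      refine (h1.sub h2).congr_deriv ?_
      ring
  have hface : ∀ t ∈ Icc 0 T, (∀ j, hf j t ≤ lev j) → ∀ k, hf k t = lev k → hf' k t < 0 := by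
    intro t _ hall k hk
    have hct : lamb < c t := lamb_lt_shrinkLevel hΛ μ t
    have hbox : ∀ j, 0 ≤ (γ t).2.2 j ∧ (γ t).2.2 j ≤ c t * w j := fun j =>
      ⟨by have := hall (Sum.inl j); simp only [hhf, hlev, Sum.elim_inl] at this; linarith,
       by have := hall (Sum.inr j); simp only [hhf, hlev, Sum.elim_inr] at this; linarith⟩
    rcases k with i | i
    · have hVi : (γ t).2.2 i = 0 := by
        have := hk; simp only [hhf, hlev, Sum.elim_inl] at this; linarith
      show -mg.dV (γ t) i < 0
      rw [mg.dV_at_zero (γ t) i hVi]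
      linarith [div_pos (hb i) (hτ i)]
    · have hVi : (γ t).2.2 i = c t * w i := by
        have := hk; simp only [hhf, hlev, Sum.elim_inr] at this; linarith
      have hc0 : 0 ≤ c t := by
        have : 0 < lamb * w i := (hb i).trans_le (hlamb i)
        have hl : 0 < lamb := by
          by_contra hneg; push Not at hneg
          have := mul_nonpos_of_nonpos_of_nonneg hneg (hw i).le
          linarith
        linarith
      show mg.dV (γ t) i + μ * (c t - lamb) * w i < 0
      have hQ := mg.Q_lower_at_top_weighted (γ t).1 (γ t).2.2 i hc0 (fun j => (hw j).le) hVi hbox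
      have hd : 0 ≤ -mg.B i i * w i - ∑ j ∈ univ.erase i, (|mg.G i j| + |mg.B i j|) * w j := by
        linarith [hdom i]
      have hQ0 : 0 ≤ mg.Q (γ t).1 (γ t).2.2 i :=
        le_trans (mul_nonneg (mul_nonneg (sq_nonneg _) (hw i).le) hd) hQ
      -- τ V̇_i ≤ b_i − c w_i ≤ −(c − λ_b) w_i
      have hnum : mg.Vset i - (γ t).2.2 i + mg.kQ i * (mg.Qset i - mg.Q (γ t).1 (γ t).2.2 i)
          ≤ -((c t - lamb) * w i) := by
        rw [hVi]
        have := mul_nonneg (hkQ i) hQ0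
        nlinarith [hlamb i]
      have hpos : 0 < (c t - lamb) * w i := mul_pos (by linarith) (hw i)
      have e : mg.dV (γ t) i * mg.τQ i
          = mg.Vset i - (γ t).2.2 i + mg.kQ i * (mg.Qset i - mg.Q (γ t).1 (γ t).2.2 i) := by
        unfold dV; exact div_mul_cancel₀ _ (hτ i).ne'
      -- compare the rates: μ τ < 1
      have key : (mg.dV (γ t) i + μ * (c t - lamb) * w i) * mg.τQ i < 0 := by
        have hμτ : μ * mg.τQ i - 1 < 0 := by linarith [hμ i]
        calc (mg.dV (γ t) i + μ * (c t - lamb) * w i) * mg.τQ i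
            = mg.dV (γ t) i * mg.τQ i + μ * mg.τQ i * ((c t - lamb) * w i) := by ring
          _ ≤ -((c t - lamb) * w i) + μ * mg.τQ i * ((c t - lamb) * w i) := by rw [e]; linarith
          _ = ((c t - lamb) * w i) * (μ * mg.τQ i - 1) := by ring
          _ < 0 := mul_neg_of_pos_of_neg hpos hμτ
      by_contra hge
      push Not at hge
      have := mul_nonneg hge (hτ i).le
      linarith
  have h0' : ∀ k, hf k 0 ≤ lev k := by
    rintro (i | i)
    · show -(γ 0).2.2 i ≤ 0; linarith [(h0 i).1]
    · show (γ 0).2.2 i - c 0 * w i ≤ 0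
      have hc0 : c 0 = Λ₀ := by simp [hcdef, shrinkLevel]
      rw [hc0]; linarith [(h0 i).2]
  intro t ht i
  have hle :=
    Literature.Analysis.ODE.forall_le_of_hasDerivWithinAt_of_eq_imp_deriv_neg hder hface h0' t ht
  refine ⟨?_, ?_⟩
  · have := hle (Sum.inl i); simp only [hhf, hlev, Sum.elim_inl] at this; linarith
  · have := hle (Sum.inr i); simp only [hhf, hlev, Sum.elim_inr] at this; linarith

/-- **Every motion with nonnegative initial voltages is attracted by the `λ_b`-box.** Same structural
hypotheses; for ANY solution on `[0, T]` with `V_i(0) ≥ 0` and any `Λ₀ > λ_b` dominating the start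
(`V_i(0) ≤ Λ₀ w_i`), the bound of `voltage_attract` holds — so with `μ > 0` the voltages satisfy
`V_i(t) ≤ λ_b w_i + (Λ₀ − λ_b) w_i e^{−μ t}`: an exponential ULTIMATE BOUND `λ_b w_i`, angles/frequencies
arbitrary. (Restatement with the rate made explicit.) -/
theorem voltage_attract_of_nonneg (hτ : ∀ i, 0 < mg.τQ i) (hkQ : ∀ i, 0 ≤ mg.kQ i)
    (hb : ∀ i, 0 < mg.Vset i + mg.kQ i * mg.Qset i)
    {w : Fin n → ℝ} (hw : ∀ i, 0 < w i)
    (hdom : ∀ i, ∑ j ∈ univ.erase i, (|mg.G i j| + |mg.B i j|) * w j ≤ -mg.B i i * w i)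
    {lamb : ℝ} (hlamb : ∀ i, mg.Vset i + mg.kQ i * mg.Qset i ≤ lamb * w i)
    {Λ₀ : ℝ} (hΛ : lamb < Λ₀) {μ : ℝ} (hμ : ∀ i, μ * mg.τQ i < 1)
    {T : ℝ} {γ : ℝ → State n} (h : mg.IsSolutionOn γ (Icc 0 T))
    (h0 : ∀ i, 0 ≤ (γ 0).2.2 i ∧ (γ 0).2.2 i ≤ Λ₀ * w i) {t : ℝ} (ht : t ∈ Icc 0 T) (i : Fin n) :
    (γ t).2.2 i ≤ lamb * w i + (Λ₀ - lamb) * w i * exp (-(μ * t)) := by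
  have := (voltage_attract hτ hkQ hb hw hdom hlamb hΛ hμ h h0 t ht i).2
  simp only [shrinkLevel] at this
  linarith

end Summit.Ventures.GridStability.Models.DroopMicrogrid

end
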